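import Summits.QuantumFields.BalabanUV.Beta.D1BFx.PackedRoadJetRows
import Summits.QuantumFields.BalabanUV.Beta.D1BFx.PackedRoadTableRows
import Summits.QuantumFields.BalabanUV.Beta.D1BFx.RestKernelSlotRowsOn
import Summits.QuantumFields.BalabanUV.Beta.D1BFx.PackedRoadRestFamily

/-!
# `BalabanUV.Beta.D1BFx.PackedRoadRowsPow` — road «BF-x» for binder row D1, slot (K): **«ROAD ROWS ON THE SUBSEQUENCE» — THE FAÇADE JOINING
# «JET ROWS AT THE ROAD» (`PackedRoadJetRows`), «TABLE ROWS AT THE ROAD» (`PackedRoadTableRows`) AND «SLOT PACK ROWS PER SCALE»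
# (`RestKernelSlotRowsOn`) AT THE ROAD's 12a JETS `Vroad a r S` ∕ `Wroad a r S₂` ON THE END's SUBSEQUENCE OF BLOCK SIZES `n = Lc^k`, `k ≥ 1`:
# EXACTLY PART 13's (i) `hMR` and (ii) READING (b) `hRu` rows of the sandwich and block lanes, from the literal's OWN sockets + units lines
# ((L1)(L2)) and the two displayed co-frame letters (C1)(C2) on the scales** (OWNER W-d1p2-g19-12: «WANTED — GO, THIS SHAPE»; RULINGs ρ-g19-1∕-2∕-3).

HONEST DEPENDENCY (cell records, verbatim): «continuum YM on T⁴ ⇐ BetaPertH ∧ nine spine estimates (0/9 proved); BetaPertH ⇐ (D1) ∧ (D4) ∧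
CAP+tail; G-an2-4 gates asym, D1 and NE2/3/4.»  HONEST FRAMING (cell contract, verbatim): «discharging `BetaPertH` makes Bałaban's UV stability
UNCONDITIONAL — a real constructive-QFT result; it is NOT the continuum limit and NOT the Clay problem.»  THIS MODULE DISCHARGES NOTHING of the
wall: [folklore] plumbing — the one-scale lemmas re-indexed on any `[NeZero N]` (one `obtain ⟨M, rfl⟩`), `Vroad a r S N` ∕ `Wroad a r S₂ N` unfolded at
`[NeZero N]`, instantiated at `N := Lc^k`; the resulting letters feed `exists_END_rows_Rk{Sand,Blk}_pow`.  The INPUT letters are HYPOTHESES: the literal's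
sockets `hS`∕`hS₂` + rate floors + units lines ((L1)(L2): d1-p3∕an2's (J1) data), and the road's two OPEN analytic (II)-rows (C1) «TB4-W CO-FRAME FIRST
JET» (counted on the COMBINED jet, RULING ρ-g19-3) and (C2) «TB4-W CO-FRAME TABLE» (leaf-03 owner, gan24-leaf-05 count), displayed ON THE SCALES.  Modulo
[B5] `h12`∕`h126` BY NAME.  No definition, no `def … : Prop`, no notation, nothing cited, 0 sorry.  0 root-level binders of row D1 discharged (hW ∕ hR-sockets ∕
hSX-socket ∕ D1Tel ∕ D1Rep — 0); (K) NOT closed; NOT D1, NOT `BetaPertH`, NOT continuum, NOT Clay.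

ABSOLUTE RULE (cell charter, verbatim): «No internally-minted statement may enter as a cited fact. Every hypothesis is either kernel-proved in
this package or a verbatim quotation of a PUBLISHED theorem with page reference. The manuscript(s) under audit are NOT citable for their own
disputed steps — they are the thing under adjudication; programme-internal (2001/route/tribunal) claims are never citable.»

CONTENT (all [folklore]).
* §1 `rate_window`, `Vroad_of_neZero`, `Wroad_of_neZero`, the `[NeZero N]`-indexed one-scale lemmas `road_jet_mass_at` ∕ `road_table_mass_at`;
  **`jet_letters_pow`** — the first-jet block letters of `Vroad a r S (Lc^k)` at every `k ≥ 1` from (L1) + (C1);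
  **`table_letters_pow`** — the second-table block letters of `Wroad a r S₂ (Lc^k) μ 0 ν z` at every `k ≥ 1` from (L2) + (C2).
* §2 **`road_sand_rows_pow`**, **`road_blk_rows_pow`** — PART 13's (i)(ii) rows of `RkSand a (Vroad a r S) (Wroad a r S₂)` ∕ `RkBlk …` at every `Lc^k`.
NOT HERE (honest): the letters themselves; the comb-FP ∕ ghost lanes (letter-free: leaf-04); the END (the OWNER's PART 14); `TshotOf`.
Unit `b2b-balaban-beta-d1-formalise-leaf-01` (gen 24), D1 formalisation swarm leaf prover 01, road «BF-x»; INTENT «ROAD ROWS ON THE SUBSEQUENCE» (journal).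
-/

noncomputable section

open Finset
open scoped BigOperators
open Literature.MathematicalPhysics.QuantumFieldTheory.Balaban1983to89
open Literature.MathematicalPhysics.QuantumFieldTheory.Balaban1983to89.Beta
open B12Sec2to5 (l1 l1_nonneg)
open B5Hk163Strip (kappa163 kappa163_pos)
open B5Hk163Decay (MG163)
open B4TorusKernel (periodConst)
open DecimatedMomentSummable (AbsMoment₂)
open ExpKernelCalculus (Site MKer BiLoc Zl)
open OneStepResolventKernel (Fib LocStencil)
open OneStepKernelFamily (KInvStep colH)
open AffineAveraging (box toSite)
open VectorTailsLoc (fam kfam)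
open Summit.QuantumFields.BalabanUV.Beta.AxialDressingRooted (coDressKBmAt)
open Summit.QuantumFields.BalabanUV.Beta.D1BFx.PackedKernelSplit (blk ffV ffW)
open Summit.QuantumFields.BalabanUV.Beta.D1BFx.PackedSortedBridges (embFF)
open Summit.QuantumFields.BalabanUV.Beta.D1BFx.FrozenLegTails (nOf MOf hn1)
open Summit.QuantumFields.BalabanUV.Beta.D1BFx.TorusWeightWordTwisted (tBw₁)
open Summit.QuantumFields.BalabanUV.Beta.D1BFx.PackedCoframePairLimit (cofPairInf)
open Summit.QuantumFields.BalabanUV.Beta.D1BFx.RestKernelSandwichSlot (RkSand CUsand)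
open Summit.QuantumFields.BalabanUV.Beta.D1BFx.RestKernelBlockSlot (RkBlk CUblk)
open Summit.QuantumFields.BalabanUV.Beta.D1BFx.RestKernelSandwichLoc (mass_blk_le_of_locStencil)
open Summit.QuantumFields.BalabanUV.Beta.D1BFx.RestKernelSlotRowsOn (exists_END_rows_RkSand_pow exists_END_rows_RkBlk_pow)
open Summit.QuantumFields.BalabanUV.Beta.D1BFx.PackedRoadJetRows (road_jet_mass_le)
open Summit.QuantumFields.BalabanUV.Beta.D1BFx.PackedRoadTableRows (road_table_mass_le)
open Summit.QuantumFields.BalabanUV.Beta.D1BFx.PackedRoadRestFamily (Vroad Wroad)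
open Summit.QuantumFields.BalabanUV.Beta.D1BFx.PackedNSideDictionary (SN)
open Summit.QuantumFields.BalabanUV.Beta.D1BFx.PackedNSidePair (W2NInf)
open OneStepKernelFamily (vertexOfK)

namespace Summit.QuantumFields.BalabanUV.Beta.D1BFx.PackedRoadRowsPow

/-! ## §1 The lane letters at the block sizes `Lc^k` -/

section Letters

variable {Lc : ℕ} [NeZero Lc]

omit [NeZero Lc] in
/-- [folklore] The rate window at a block size `N ≥ 1`: `0 ≤ σV∕N ≤ κ′∕(16N)` for `0 ≤ σV ≤ κ′∕16`. -/
theorem rate_window {σV : ℝ} (hσV0 : 0 ≤ σV) (hσVκ : σV ≤ kappa163 4 / 4 / 16) (N : ℕ) [NeZero N] :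
    0 ≤ σV / ((N : ℕ) : ℝ) ∧ σV / ((N : ℕ) : ℝ) ≤ kappa163 4 / 4 / (16 * ((N : ℕ) : ℝ)) := by
  have hn0 : (0 : ℝ) < ((N : ℕ) : ℝ) := by exact_mod_cast Nat.pos_of_ne_zero (NeZero.ne N)
  refine ⟨div_nonneg hσV0 hn0.le, ?_⟩
  calc σV / ((N : ℕ) : ℝ) ≤ kappa163 4 / 4 / 16 / ((N : ℕ) : ℝ) := div_le_div_of_nonneg_right hσVκ hn0.le
    _ = kappa163 4 / 4 / (16 * ((N : ℕ) : ℝ)) := div_div _ _ _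

omit [NeZero Lc] in
/-- [our object] **`Vroad` AT ANY `[NeZero N]`**: `Vroad a r S N = vertexOfK G₀(r N) N (SN (N − 1) a (S N))` (the pattern-matching definition, one `obtain`). -/
theorem Vroad_of_neZero (a : ℝ) (r : ℕ → Fin (3 + 1) → ℕ) (S : ℕ → Fin 4 → (Fin 4 → ℤ) → MKer 4 (Fib 3)) (N : ℕ) [NeZero N] :
    Vroad a r S N = vertexOfK (coDressKBmAt (toSite (r N)) N (KInvStep (d := 3) N 0)) N (SN (N - 1) a (S N)) := by
  obtain ⟨M, rfl⟩ : ∃ M, N = M + 1 := ⟨N - 1, (Nat.succ_pred_eq_of_ne_zero (NeZero.ne N)).symm⟩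
  rfl

omit [NeZero Lc] in
/-- [our object] **`Wroad` AT ANY `[NeZero N]`**: `Wroad a r S₂ N = W2NInf (N − 1) a (r N) (S₂ N)`. -/
theorem Wroad_of_neZero (a : ℝ) (r : ℕ → Fin (3 + 1) → ℕ) (S₂ : ℕ → Fin 4 → (Fin 4 → ℤ) → Fin 4 → (Fin 4 → ℤ) → MKer 4 (Fib 3))
    (N : ℕ) [NeZero N] : Wroad a r S₂ N = W2NInf (N - 1) a (r N) (S₂ N) := by
  obtain ⟨M, rfl⟩ : ∃ M, N = M + 1 := ⟨N - 1, (Nat.succ_pred_eq_of_ne_zero (NeZero.ne N)).symm⟩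
  rfl

omit [NeZero Lc] in
/-- [folklore] **«JET ROWS AT THE ROAD» AT ANY BLOCK SIZE `[NeZero N]`** — `PackedRoadJetRows.road_jet_mass_le` re-indexed on `N` (jets
`vertexOfK G₀(r) N (SN (N−1) a S)`, co-frame letter at `tBw₁ N a κ u`), so that it applies at `N := Lc^k` with no rewriting of the scale. -/
theorem road_jet_mass_at (N : ℕ) [NeZero N] {a : ℝ} {r : Fin (3 + 1) → ℕ} (hr : r ∈ box (3 + 1) N) {S : Fin 4 → (Fin 4 → ℤ) → MKer 4 (Fib 3)}
    {σ : ℝ} (hσ0 : 0 ≤ σ) (hσ : σ ≤ kappa163 4 / 4 / (16 * ((N : ℕ) : ℝ))) {mS : Bool → Bool → ℝ} {mT : ℝ}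
    (hSs : ∀ κ u j k, Summable fun p : Site 4 × Site 4 =>
      ∑ g, ∑ f, |blk (S κ u) j k p.1 p.2 g f| * Real.exp (σ * (l1 (p.1 - u) + l1 (p.2 - u))))
    (hSm : ∀ κ u j k, ∑' p : Site 4 × Site 4,
      ∑ g, ∑ f, |blk (S κ u) j k p.1 p.2 g f| * Real.exp (σ * (l1 (p.1 - u) + l1 (p.2 - u))) ≤ mS j k)
    (hTs : ∀ κ u, Summable fun p : Site 4 × Site 4 =>
      ∑ g, ∑ f, |tBw₁ N a κ u p.1 p.2 g f| * Real.exp (σ * (l1 (p.1 - u) + l1 (p.2 - u))))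
    (hTm : ∀ κ u, ∑' p : Site 4 × Site 4,
      ∑ g, ∑ f, |tBw₁ N a κ u p.1 p.2 g f| * Real.exp (σ * (l1 (p.1 - u) + l1 (p.2 - u))) ≤ mT)
    (ρ : Fin (3 + 1)) (y : Fin (3 + 1) → ℤ) (j k : Bool) :
    (Summable fun p : Site 4 × Site 4 => ∑ g, ∑ f,
        |blk (vertexOfK (coDressKBmAt (toSite r) N (KInvStep (d := 3) N 0)) N (SN (N - 1) a S) ρ y) j k p.1 p.2 g f|
          * Real.exp (σ * (l1 (p.1 - ((N : ℕ) : ℤ) • y) + l1 (p.2 - ((N : ℕ) : ℤ) • y)))) ∧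
      ∑' p : Site 4 × Site 4, ∑ g, ∑ f,
          |blk (vertexOfK (coDressKBmAt (toSite r) N (KInvStep (d := 3) N 0)) N (SN (N - 1) a S) ρ y) j k p.1 p.2 g f|
            * Real.exp (σ * (l1 (p.1 - ((N : ℕ) : ℤ) • y) + l1 (p.2 - ((N : ℕ) : ℤ) • y)))
        ≤ 4 * ((MG163 4 * periodConst (kappa163 4) 3) * (1 + 8 * (1 + Real.exp (kappa163 4 / 4))) * Real.exp (kappa163 4 / 4))
            * (1 + 16 / (kappa163 4 / 4)) ^ 4 * (mS j k + (bif (j && k) then mT else 0)) := by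
  obtain ⟨M, rfl⟩ : ∃ M, N = M + 1 := ⟨N - 1, (Nat.succ_pred_eq_of_ne_zero (NeZero.ne N)).symm⟩
  exact road_jet_mass_le M hr hσ0 hσ hSs hSm hTs hTm ρ y j k

omit [NeZero Lc] in
/-- [folklore] **«TABLE ROWS AT THE ROAD» AT ANY BLOCK SIZE `[NeZero N]`** — `PackedRoadTableRows.road_table_mass_le` re-indexed on `N` (tables
`W2NInf (N−1) a r S₂`, floor `δ₀∕N ≤ δ₂`, co-frame letter at `cofPairInf N a (colH G₀(r) N μ 0) (colH G₀(r) N ν z)`). -/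
theorem road_table_mass_at (N : ℕ) [NeZero N] {a : ℝ} {r : Fin (3 + 1) → ℕ} (hr : r ∈ box (3 + 1) N)
    {S₂ : Fin 4 → (Fin 4 → ℤ) → Fin 4 → (Fin 4 → ℤ) → MKer 4 (Fib 3)} {Ck δ₂ : ℝ}
    (hS₂ : ∀ κ u κ' u', BiLoc (S₂ κ u κ' u') u u (Ck * Real.exp (-δ₂ * l1 (u' - u))) δ₂) (hCk : 0 ≤ Ck) (hδ₂ : 0 < δ₂)
    {δ₀ : ℝ} (hδ₀ : 0 < δ₀) (hδ₀₂ : δ₀ / ((N : ℕ) : ℝ) ≤ δ₂) {uT : ℝ} (huT : 16 * Ck * Zl 4 (δ₂ / 2) ^ 2 ≤ uT)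
    {μ ν : Fin 4} {mC : Bool → Bool → ℝ} {κc : ℝ}
    (hCs : ∀ (z : Site 4) (j i : Bool), Summable fun q : Site 4 × Site 4 => ∑ g, ∑ f,
      |blk (embFF (cofPairInf N a (colH (coDressKBmAt (toSite r) N (KInvStep (d := 3) N 0)) N μ 0)
        (colH (coDressKBmAt (toSite r) N (KInvStep (d := 3) N 0)) N ν z))) j i q.1 q.2 g f|)
    (hCm : ∀ (z : Site 4) (j i : Bool), ∑' q : Site 4 × Site 4, ∑ g, ∑ f,
      |blk (embFF (cofPairInf N a (colH (coDressKBmAt (toSite r) N (KInvStep (d := 3) N 0)) N μ 0)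
        (colH (coDressKBmAt (toSite r) N (KInvStep (d := 3) N 0)) N ν z))) j i q.1 q.2 g f| ≤ mC j i * Real.exp (-κc * l1 z))
    (z : Site 4) (j i : Bool) :
    (Summable fun q : Site 4 × Site 4 => ∑ g, ∑ f, |blk (W2NInf (N - 1) a r S₂ μ 0 ν z) j i q.1 q.2 g f|) ∧
      ∑' q : Site 4 × Site 4, ∑ g, ∑ f, |blk (W2NInf (N - 1) a r S₂ μ 0 ν z) j i q.1 q.2 g f|
        ≤ (16 * ((MG163 4 * periodConst (kappa163 4) 3) * (1 + 8 * (1 + Real.exp (kappa163 4 / 4))) * Real.exp (kappa163 4 / 4)) ^ 2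
              * (1 + 16 / (kappa163 4 / 4)) ^ 4 * (1 + 4 / δ₀) ^ 4 * uT + mC j i)
          * Real.exp (-(min (kappa163 4 / 4 / 8) (min (δ₀ / 2) κc)) * l1 z) := by
  obtain ⟨M, rfl⟩ : ∃ M, N = M + 1 := ⟨N - 1, (Nat.succ_pred_eq_of_ne_zero (NeZero.ne N)).symm⟩
  exact road_table_mass_le M hr hS₂ hCk hδ₂ hδ₀ hδ₀₂ huT hCs hCm z j i

variable {a : ℝ} {r : ℕ → Fin (3 + 1) → ℕ} {S : ℕ → Fin 4 → (Fin 4 → ℤ) → MKer 4 (Fib 3)}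
  {S₂ : ℕ → Fin 4 → (Fin 4 → ℤ) → Fin 4 → (Fin 4 → ℤ) → MKer 4 (Fib 3)} {μ ν : Fin 4}

/-- [folklore] **THE FIRST-JET BLOCK LETTERS OF `Vroad a r S (Lc^k)`, `k ≥ 1`, FROM (L1) + (C1) ON THE SCALES.**  Inputs: `2 ≤ Lc`; the roots
`hr : ∀ m, r (m+1) ∈ box 4 (m+1)`; the literal's first-stencil socket `hS : ∀ n ≥ 2, LocStencil (S n) (Cs n) (δS n)` with `0 ≤ Cs n`, `0 < δS n`; one n-free rate
`0 ≤ σV ≤ κ′∕16` below the floor `σV∕n ≤ δS n∕2`; ONE units inequality `16·Cs n·Zl 4 (δS n∕2)² ≤ uS` (all `n ≥ 2`); and (C1) ON THE SCALES: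
`tBw₁ (Lc^k) a κ u` has `u`-centred `σV∕Lc^k`-weighted mass `≤ mT`.  Output: the blocks of `Vroad a r S (Lc^k) ρ y` have `(Lc^k)•y`-centred `σV∕Lc^k`-weighted
masses, summable and `≤ 4·C_{G₀}·(1+16∕κ′)⁴·(uS + [tt]·mT)`. -/
theorem jet_letters_pow (hL : 2 ≤ Lc) (hr : ∀ m : ℕ, r (m + 1) ∈ box (3 + 1) (m + 1))
    {Cs δS : ℕ → ℝ} (hS : ∀ n : ℕ, 2 ≤ n → LocStencil (S n) (Cs n) (δS n)) (hCs : ∀ n, 0 ≤ Cs n) (hδS : ∀ n, 0 < δS n)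
    {σV : ℝ} (hσV0 : 0 ≤ σV) (hσVκ : σV ≤ kappa163 4 / 4 / 16) (hσVS : ∀ n : ℕ, 2 ≤ n → σV / (n : ℝ) ≤ δS n / 2)
    {uS : ℝ} (huS : ∀ n : ℕ, 2 ≤ n → 16 * Cs n * Zl 4 (δS n / 2) ^ 2 ≤ uS) {mT : ℝ}
    (hTs : ∀ (k : ℕ), 1 ≤ k → ∀ (κ : Fin 4) (u : Fin 4 → ℤ), Summable fun p : Site 4 × Site 4 =>
      ∑ g, ∑ f, |tBw₁ (Lc ^ k) a κ u p.1 p.2 g f| * Real.exp (σV / ((Lc ^ k : ℕ) : ℝ) * (l1 (p.1 - u) + l1 (p.2 - u))))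
    (hTm : ∀ (k : ℕ), 1 ≤ k → ∀ (κ : Fin 4) (u : Fin 4 → ℤ), ∑' p : Site 4 × Site 4,
      ∑ g, ∑ f, |tBw₁ (Lc ^ k) a κ u p.1 p.2 g f| * Real.exp (σV / ((Lc ^ k : ℕ) : ℝ) * (l1 (p.1 - u) + l1 (p.2 - u))) ≤ mT) :
    (∀ (k : ℕ), 1 ≤ k → ∀ (ρ : Fin 4) (y : Site 4) (j k' : Bool), Summable fun p : Site 4 × Site 4 =>
      ∑ g, ∑ f, |blk (Vroad a r S (Lc ^ k) ρ y) j k' p.1 p.2 g f|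
        * Real.exp (σV / ((Lc ^ k : ℕ) : ℝ) * (l1 (p.1 - ((Lc ^ k : ℕ) : ℤ) • y) + l1 (p.2 - ((Lc ^ k : ℕ) : ℤ) • y)))) ∧
    (∀ (k : ℕ), 1 ≤ k → ∀ (ρ : Fin 4) (y : Site 4) (j k' : Bool), ∑' p : Site 4 × Site 4,
      ∑ g, ∑ f, |blk (Vroad a r S (Lc ^ k) ρ y) j k' p.1 p.2 g f|
        * Real.exp (σV / ((Lc ^ k : ℕ) : ℝ) * (l1 (p.1 - ((Lc ^ k : ℕ) : ℤ) • y) + l1 (p.2 - ((Lc ^ k : ℕ) : ℤ) • y)))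
      ≤ 4 * ((MG163 4 * periodConst (kappa163 4) 3) * (1 + 8 * (1 + Real.exp (kappa163 4 / 4))) * Real.exp (kappa163 4 / 4))
            * (1 + 16 / (kappa163 4 / 4)) ^ 4 * (uS + (bif (j && k') then mT else 0))) := by
  -- at each scale: write `Lc^k = M + 1`, read the literal letters at block size `M + 1`, apply `road_jet_mass_le M`
  have key : ∀ (k : ℕ), 1 ≤ k → ∀ (ρ : Fin 4) (y : Site 4) (j k' : Bool),
      (Summable fun p : Site 4 × Site 4 => ∑ g, ∑ f, |blk (Vroad a r S (Lc ^ k) ρ y) j k' p.1 p.2 g f|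
        * Real.exp (σV / ((Lc ^ k : ℕ) : ℝ) * (l1 (p.1 - ((Lc ^ k : ℕ) : ℤ) • y) + l1 (p.2 - ((Lc ^ k : ℕ) : ℤ) • y)))) ∧
      ∑' p : Site 4 × Site 4, ∑ g, ∑ f, |blk (Vroad a r S (Lc ^ k) ρ y) j k' p.1 p.2 g f|
        * Real.exp (σV / ((Lc ^ k : ℕ) : ℝ) * (l1 (p.1 - ((Lc ^ k : ℕ) : ℤ) • y) + l1 (p.2 - ((Lc ^ k : ℕ) : ℤ) • y)))
      ≤ 4 * ((MG163 4 * periodConst (kappa163 4) 3) * (1 + 8 * (1 + Real.exp (kappa163 4 / 4))) * Real.exp (kappa163 4 / 4))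
            * (1 + 16 / (kappa163 4 / 4)) ^ 4 * (uS + (bif (j && k') then mT else 0)) := by
    intro k hk ρ y j k'
    have hn2 : 2 ≤ Lc ^ k := hL.trans (Nat.le_self_pow (Nat.one_le_iff_ne_zero.mp hk) Lc)
    have hrk : r (Lc ^ k) ∈ box (3 + 1) (Lc ^ k) := by
      have h := hr (Lc ^ k - 1)
      rwa [Nat.sub_add_cancel (Nat.one_le_pow _ _ (Nat.pos_of_ne_zero (NeZero.ne Lc)))] at h
    have hlit : ∀ (κ : Fin 4) (u : Fin 4 → ℤ) (j k' : Bool),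
        (Summable fun p : Site 4 × Site 4 => ∑ g, ∑ f, |blk (S (Lc ^ k) κ u) j k' p.1 p.2 g f|
          * Real.exp (σV / ((Lc ^ k : ℕ) : ℝ) * (l1 (p.1 - u) + l1 (p.2 - u)))) ∧
        ∑' p : Site 4 × Site 4, ∑ g, ∑ f, |blk (S (Lc ^ k) κ u) j k' p.1 p.2 g f|
          * Real.exp (σV / ((Lc ^ k : ℕ) : ℝ) * (l1 (p.1 - u) + l1 (p.2 - u))) ≤ uS := fun κ u j k' => by
      have h := mass_blk_le_of_locStencil (hS (Lc ^ k) hn2) (hCs (Lc ^ k)) (hδS (Lc ^ k)) (hσVS (Lc ^ k) hn2) κ u j k'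
      exact ⟨h.1, h.2.trans (huS (Lc ^ k) hn2)⟩
    rw [Vroad_of_neZero]
    exact road_jet_mass_at (Lc ^ k) hrk (S := S (Lc ^ k)) (mS := fun _ _ => uS) (rate_window hσV0 hσVκ (Lc ^ k)).1
      (rate_window hσV0 hσVκ (Lc ^ k)).2 (fun κ u j k' => (hlit κ u j k').1) (fun κ u j k' => (hlit κ u j k').2) (hTs k hk) (hTm k hk) ρ y j k'
  exact ⟨fun k hk ρ y j k' => (key k hk ρ y j k').1, fun k hk ρ y j k' => (key k hk ρ y j k').2⟩

/-- [folklore] **THE SECOND-TABLE BLOCK LETTERS OF `Wroad a r S₂ (Lc^k) μ 0 ν z`, `k ≥ 1`, FROM (L2) + (C2) ON THE SCALES.**  Inputs: the roots `hr`; the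
literal's pair socket `hS₂ : ∀ n ≥ 2, BiLoc (S₂ n κ u κ′ u′) u u (Ck n·e^{−δ₂ n|u′−u|₁}) (δ₂ n)` with `0 ≤ Ck n`, `0 < δ₂ n`; a block-scale floor `δ₀∕n ≤ δ₂ n`
(`0 < δ₀`); ONE units inequality `16·Ck n·Zl 4 (δ₂ n∕2)² ≤ uT`; and (C2) ON THE SCALES at the base bond `(μ, 0)`.  Output: the blocks of
`Wroad a r S₂ (Lc^k) μ 0 ν z` have summable plain masses `≤ (16·C_{G₀}²·(1+16∕κ′)⁴·(1+4∕δ₀)⁴·uT + mC j i)·e^{−min (κ′∕8) (min (δ₀∕2) κc)·|z|₁}`. -/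
theorem table_letters_pow (hL : 2 ≤ Lc) (hr : ∀ m : ℕ, r (m + 1) ∈ box (3 + 1) (m + 1))
    {Ck δ₂ : ℕ → ℝ} (hS₂ : ∀ n : ℕ, 2 ≤ n → ∀ κ u κ' u', BiLoc (S₂ n κ u κ' u') u u (Ck n * Real.exp (-δ₂ n * l1 (u' - u))) (δ₂ n))
    (hCk : ∀ n, 0 ≤ Ck n) (hδ₂ : ∀ n, 0 < δ₂ n)
    {δ₀ : ℝ} (hδ₀ : 0 < δ₀) (hδ₀₂ : ∀ n : ℕ, 2 ≤ n → δ₀ / (n : ℝ) ≤ δ₂ n) {uT : ℝ} (huT : ∀ n : ℕ, 2 ≤ n → 16 * Ck n * Zl 4 (δ₂ n / 2) ^ 2 ≤ uT)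
    {mC : Bool → Bool → ℝ} {κc : ℝ}
    (hCs : ∀ (k : ℕ), 1 ≤ k → ∀ (z : Site 4) (j i : Bool), Summable fun q : Site 4 × Site 4 => ∑ g, ∑ f,
      |blk (embFF (cofPairInf (Lc ^ k) a (colH (coDressKBmAt (toSite (r (Lc ^ k))) (Lc ^ k) (KInvStep (d := 3) (Lc ^ k) 0)) (Lc ^ k) μ 0)
        (colH (coDressKBmAt (toSite (r (Lc ^ k))) (Lc ^ k) (KInvStep (d := 3) (Lc ^ k) 0)) (Lc ^ k) ν z))) j i q.1 q.2 g f|)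
    (hCm : ∀ (k : ℕ), 1 ≤ k → ∀ (z : Site 4) (j i : Bool), ∑' q : Site 4 × Site 4, ∑ g, ∑ f,
      |blk (embFF (cofPairInf (Lc ^ k) a (colH (coDressKBmAt (toSite (r (Lc ^ k))) (Lc ^ k) (KInvStep (d := 3) (Lc ^ k) 0)) (Lc ^ k) μ 0)
        (colH (coDressKBmAt (toSite (r (Lc ^ k))) (Lc ^ k) (KInvStep (d := 3) (Lc ^ k) 0)) (Lc ^ k) ν z))) j i q.1 q.2 g f|
        ≤ mC j i * Real.exp (-κc * l1 z)) :
    (∀ (k : ℕ), 1 ≤ k → ∀ (z : Site 4) (j i : Bool), Summable fun q : Site 4 × Site 4 => ∑ g, ∑ f,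
      |blk (Wroad a r S₂ (Lc ^ k) μ 0 ν z) j i q.1 q.2 g f|) ∧
    (∀ (k : ℕ), 1 ≤ k → ∀ (z : Site 4) (j i : Bool), ∑' q : Site 4 × Site 4, ∑ g, ∑ f,
      |blk (Wroad a r S₂ (Lc ^ k) μ 0 ν z) j i q.1 q.2 g f|
      ≤ (16 * ((MG163 4 * periodConst (kappa163 4) 3) * (1 + 8 * (1 + Real.exp (kappa163 4 / 4))) * Real.exp (kappa163 4 / 4)) ^ 2
            * (1 + 16 / (kappa163 4 / 4)) ^ 4 * (1 + 4 / δ₀) ^ 4 * uT + mC j i)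
        * Real.exp (-(min (kappa163 4 / 4 / 8) (min (δ₀ / 2) κc)) * l1 z)) := by
  have key : ∀ (k : ℕ), 1 ≤ k → ∀ (z : Site 4) (j i : Bool),
      (Summable fun q : Site 4 × Site 4 => ∑ g, ∑ f, |blk (Wroad a r S₂ (Lc ^ k) μ 0 ν z) j i q.1 q.2 g f|) ∧
      ∑' q : Site 4 × Site 4, ∑ g, ∑ f, |blk (Wroad a r S₂ (Lc ^ k) μ 0 ν z) j i q.1 q.2 g f|
      ≤ (16 * ((MG163 4 * periodConst (kappa163 4) 3) * (1 + 8 * (1 + Real.exp (kappa163 4 / 4))) * Real.exp (kappa163 4 / 4)) ^ 2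
            * (1 + 16 / (kappa163 4 / 4)) ^ 4 * (1 + 4 / δ₀) ^ 4 * uT + mC j i)
        * Real.exp (-(min (kappa163 4 / 4 / 8) (min (δ₀ / 2) κc)) * l1 z) := by
    intro k hk z j i
    have hn2 : 2 ≤ Lc ^ k := hL.trans (Nat.le_self_pow (Nat.one_le_iff_ne_zero.mp hk) Lc)
    have hrk : r (Lc ^ k) ∈ box (3 + 1) (Lc ^ k) := by
      have h := hr (Lc ^ k - 1)
      rwa [Nat.sub_add_cancel (Nat.one_le_pow _ _ (Nat.pos_of_ne_zero (NeZero.ne Lc)))] at h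
    rw [Wroad_of_neZero]
    exact road_table_mass_at (Lc ^ k) hrk (hS₂ (Lc ^ k) hn2) (hCk (Lc ^ k)) (hδ₂ (Lc ^ k)) hδ₀ (hδ₀₂ (Lc ^ k) hn2) (huT (Lc ^ k) hn2)
      (hCs k hk) (hCm k hk) z j i
  exact ⟨fun k hk z j i => (key k hk z j i).1, fun k hk z j i => (key k hk z j i).2⟩

end Letters

/-! ## §2 PART 13's sandwich ∕ block rows at the road's jets on the subsequence -/

section Rows

variable {Lc : ℕ} [NeZero Lc] {a : ℝ} (ha : 0 < a) {r : ℕ → Fin (3 + 1) → ℕ} {S : ℕ → Fin 4 → (Fin 4 → ℤ) → MKer 4 (Fib 3)}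
  {S₂ : ℕ → Fin 4 → (Fin 4 → ℤ) → Fin 4 → (Fin 4 → ℤ) → MKer 4 (Fib 3)} {μ ν : Fin 4}
  {Cs δS Ck δ₂ : ℕ → ℝ} {σV uS mT δ₀ uT κc : ℝ} {mC : Bool → Bool → ℝ}
include ha

/-- [folklore] **«ROAD ROWS ON THE SUBSEQUENCE» — THE BLOCK LANE**: PART 13's (i) `hMR` and (ii) READING (b) `hRu` (`Ru := 0`) for
`RkBlk a (Vroad a r S) (Wroad a r S₂)` at every `Lc^k`, `k ≥ 1`, from `2 ≤ Lc`, [B5] BY NAME, the roots `hr`, the literal's sockets + floors + units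
((L1)(L2)), `0 < σV ≤ κ′∕16`, `0 < δ₀`, `0 < κc`, and (C1)(C2) ON THE SCALES; `CU′ := CUblk kG K c σV mV κV mW` with
`mV j k := 4·C_{G₀}·(1+16∕κ′)⁴·(uS + [tt]·mT)`, `κV := min (κ′∕8) (min (δ₀∕2) κc)`, `mW j i := 16·C_{G₀}²·(1+16∕κ′)⁴·(1+4∕δ₀)⁴·uT + mC j i`. -/
theorem road_blk_rows_pow (hL : 2 ≤ Lc) (h12 : B5.Prop12Printed (fam nOf hn1 MOf a ha)) (h126 : B5.Kernel126_127Printed (kfam nOf MOf))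
    (hr : ∀ m : ℕ, r (m + 1) ∈ box (3 + 1) (m + 1))
    (hS : ∀ n : ℕ, 2 ≤ n → LocStencil (S n) (Cs n) (δS n)) (hCs : ∀ n, 0 ≤ Cs n) (hδS : ∀ n, 0 < δS n)
    (hσV : 0 < σV) (hσVκ : σV ≤ kappa163 4 / 4 / 16) (hσVS : ∀ n : ℕ, 2 ≤ n → σV / (n : ℝ) ≤ δS n / 2)
    (huS : ∀ n : ℕ, 2 ≤ n → 16 * Cs n * Zl 4 (δS n / 2) ^ 2 ≤ uS)
    (hTs : ∀ (k : ℕ), 1 ≤ k → ∀ (κ : Fin 4) (u : Fin 4 → ℤ), Summable fun p : Site 4 × Site 4 =>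
      ∑ g, ∑ f, |tBw₁ (Lc ^ k) a κ u p.1 p.2 g f| * Real.exp (σV / ((Lc ^ k : ℕ) : ℝ) * (l1 (p.1 - u) + l1 (p.2 - u))))
    (hTm : ∀ (k : ℕ), 1 ≤ k → ∀ (κ : Fin 4) (u : Fin 4 → ℤ), ∑' p : Site 4 × Site 4,
      ∑ g, ∑ f, |tBw₁ (Lc ^ k) a κ u p.1 p.2 g f| * Real.exp (σV / ((Lc ^ k : ℕ) : ℝ) * (l1 (p.1 - u) + l1 (p.2 - u))) ≤ mT)
    (hS₂ : ∀ n : ℕ, 2 ≤ n → ∀ κ u κ' u', BiLoc (S₂ n κ u κ' u') u u (Ck n * Real.exp (-δ₂ n * l1 (u' - u))) (δ₂ n))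
    (hCk : ∀ n, 0 ≤ Ck n) (hδ₂ : ∀ n, 0 < δ₂ n)
    (hδ₀ : 0 < δ₀) (hδ₀₂ : ∀ n : ℕ, 2 ≤ n → δ₀ / (n : ℝ) ≤ δ₂ n) (huT : ∀ n : ℕ, 2 ≤ n → 16 * Ck n * Zl 4 (δ₂ n / 2) ^ 2 ≤ uT)
    (hκc : 0 < κc)
    (hCs' : ∀ (k : ℕ), 1 ≤ k → ∀ (z : Site 4) (j i : Bool), Summable fun q : Site 4 × Site 4 => ∑ g, ∑ f,
      |blk (embFF (cofPairInf (Lc ^ k) a (colH (coDressKBmAt (toSite (r (Lc ^ k))) (Lc ^ k) (KInvStep (d := 3) (Lc ^ k) 0)) (Lc ^ k) μ 0)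
        (colH (coDressKBmAt (toSite (r (Lc ^ k))) (Lc ^ k) (KInvStep (d := 3) (Lc ^ k) 0)) (Lc ^ k) ν z))) j i q.1 q.2 g f|)
    (hCm : ∀ (k : ℕ), 1 ≤ k → ∀ (z : Site 4) (j i : Bool), ∑' q : Site 4 × Site 4, ∑ g, ∑ f,
      |blk (embFF (cofPairInf (Lc ^ k) a (colH (coDressKBmAt (toSite (r (Lc ^ k))) (Lc ^ k) (KInvStep (d := 3) (Lc ^ k) 0)) (Lc ^ k) μ 0)
        (colH (coDressKBmAt (toSite (r (Lc ^ k))) (Lc ^ k) (KInvStep (d := 3) (Lc ^ k) 0)) (Lc ^ k) ν z))) j i q.1 q.2 g f|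
        ≤ mC j i * Real.exp (-κc * l1 z)) :
    ∃ kG K c : ℝ, 0 < c ∧ 0 ≤ kG ∧ 0 ≤ K ∧
      (∀ (u : (Bool × Bool) ⊕ (Bool × Bool × Bool × Bool)) (k : ℕ), 1 ≤ k → AbsMoment₂ (RkBlk a (Vroad a r S) (Wroad a r S₂) u (Lc ^ k) μ ν)) ∧
      (∀ (u : (Bool × Bool) ⊕ (Bool × Bool × Bool × Bool)) (k : ℕ), 1 ≤ k →
        |B12Beta.secondMoment (RkBlk a (Vroad a r S) (Wroad a r S₂) u (Lc ^ k)) μ ν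
          - (fun (_ : (Bool × Bool) ⊕ (Bool × Bool × Bool × Bool)) (_ : ℕ) => (0 : ℝ)) u (Lc ^ k)|
          ≤ CUblk kG K c σV (fun j k' => 4 * ((MG163 4 * periodConst (kappa163 4) 3) * (1 + 8 * (1 + Real.exp (kappa163 4 / 4))) * Real.exp (kappa163 4 / 4))
              * (1 + 16 / (kappa163 4 / 4)) ^ 4 * (uS + (bif (j && k') then mT else 0)))
            (min (kappa163 4 / 4 / 8) (min (δ₀ / 2) κc))
            (fun j i => 16 * ((MG163 4 * periodConst (kappa163 4) 3) * (1 + 8 * (1 + Real.exp (kappa163 4 / 4))) * Real.exp (kappa163 4 / 4)) ^ 2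
              * (1 + 16 / (kappa163 4 / 4)) ^ 4 * (1 + 4 / δ₀) ^ 4 * uT + mC j i) u) := by
  obtain ⟨hVs, hVm⟩ := jet_letters_pow (Lc := Lc) hL hr hS hCs hδS hσV.le hσVκ hσVS huS hTs hTm
  obtain ⟨hWs, hWm⟩ := table_letters_pow (Lc := Lc) (μ := μ) (ν := ν) hL hr hS₂ hCk hδ₂ hδ₀ hδ₀₂ huT hCs' hCm
  have key := exists_END_rows_RkBlk_pow (Lc := Lc) (𝒱 := Vroad a r S) (𝒲 := Wroad a r S₂) (μ := μ) (ν := ν) ha h12 h126 hσV hVs hVm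
    (PackedRoadTableRows.road_tableRate_pos hδ₀ hκc) hWs hWm
  obtain ⟨kG, K, c, hc, hkG, hK, h1, h2, -⟩ := key
  exact ⟨kG, K, c, hc, hkG, hK, h1, h2⟩

/-- [folklore] **«ROAD ROWS ON THE SUBSEQUENCE» — THE SANDWICH LANE** (the ff instances of the same letters): PART 13's (i)(ii) rows for
`RkSand a (Vroad a r S) (Wroad a r S₂)` at every `Lc^k`, `k ≥ 1`, `CU′ := CUsand kG K c σV (4·C_{G₀}·(1+16∕κ′)⁴·(uS + mT)) κV (16·C_{G₀}²·(1+16∕κ′)⁴·(1+4∕δ₀)⁴·uT + mC tt)`. -/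
theorem road_sand_rows_pow (hL : 2 ≤ Lc) (h12 : B5.Prop12Printed (fam nOf hn1 MOf a ha)) (h126 : B5.Kernel126_127Printed (kfam nOf MOf))
    (hr : ∀ m : ℕ, r (m + 1) ∈ box (3 + 1) (m + 1))
    (hS : ∀ n : ℕ, 2 ≤ n → LocStencil (S n) (Cs n) (δS n)) (hCs : ∀ n, 0 ≤ Cs n) (hδS : ∀ n, 0 < δS n)
    (hσV : 0 < σV) (hσVκ : σV ≤ kappa163 4 / 4 / 16) (hσVS : ∀ n : ℕ, 2 ≤ n → σV / (n : ℝ) ≤ δS n / 2)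
    (huS : ∀ n : ℕ, 2 ≤ n → 16 * Cs n * Zl 4 (δS n / 2) ^ 2 ≤ uS)
    (hTs : ∀ (k : ℕ), 1 ≤ k → ∀ (κ : Fin 4) (u : Fin 4 → ℤ), Summable fun p : Site 4 × Site 4 =>
      ∑ g, ∑ f, |tBw₁ (Lc ^ k) a κ u p.1 p.2 g f| * Real.exp (σV / ((Lc ^ k : ℕ) : ℝ) * (l1 (p.1 - u) + l1 (p.2 - u))))
    (hTm : ∀ (k : ℕ), 1 ≤ k → ∀ (κ : Fin 4) (u : Fin 4 → ℤ), ∑' p : Site 4 × Site 4,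
      ∑ g, ∑ f, |tBw₁ (Lc ^ k) a κ u p.1 p.2 g f| * Real.exp (σV / ((Lc ^ k : ℕ) : ℝ) * (l1 (p.1 - u) + l1 (p.2 - u))) ≤ mT)
    (hS₂ : ∀ n : ℕ, 2 ≤ n → ∀ κ u κ' u', BiLoc (S₂ n κ u κ' u') u u (Ck n * Real.exp (-δ₂ n * l1 (u' - u))) (δ₂ n))
    (hCk : ∀ n, 0 ≤ Ck n) (hδ₂ : ∀ n, 0 < δ₂ n)
    (hδ₀ : 0 < δ₀) (hδ₀₂ : ∀ n : ℕ, 2 ≤ n → δ₀ / (n : ℝ) ≤ δ₂ n) (huT : ∀ n : ℕ, 2 ≤ n → 16 * Ck n * Zl 4 (δ₂ n / 2) ^ 2 ≤ uT)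
    (hκc : 0 < κc)
    (hCs' : ∀ (k : ℕ), 1 ≤ k → ∀ (z : Site 4) (j i : Bool), Summable fun q : Site 4 × Site 4 => ∑ g, ∑ f,
      |blk (embFF (cofPairInf (Lc ^ k) a (colH (coDressKBmAt (toSite (r (Lc ^ k))) (Lc ^ k) (KInvStep (d := 3) (Lc ^ k) 0)) (Lc ^ k) μ 0)
        (colH (coDressKBmAt (toSite (r (Lc ^ k))) (Lc ^ k) (KInvStep (d := 3) (Lc ^ k) 0)) (Lc ^ k) ν z))) j i q.1 q.2 g f|)
    (hCm : ∀ (k : ℕ), 1 ≤ k → ∀ (z : Site 4) (j i : Bool), ∑' q : Site 4 × Site 4, ∑ g, ∑ f,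
      |blk (embFF (cofPairInf (Lc ^ k) a (colH (coDressKBmAt (toSite (r (Lc ^ k))) (Lc ^ k) (KInvStep (d := 3) (Lc ^ k) 0)) (Lc ^ k) μ 0)
        (colH (coDressKBmAt (toSite (r (Lc ^ k))) (Lc ^ k) (KInvStep (d := 3) (Lc ^ k) 0)) (Lc ^ k) ν z))) j i q.1 q.2 g f|
        ≤ mC j i * Real.exp (-κc * l1 z)) :
    ∃ kG K c : ℝ, 0 < c ∧ 0 ≤ kG ∧ 0 ≤ K ∧
      (∀ (u : Unit ⊕ (Bool × Bool)) (k : ℕ), 1 ≤ k → AbsMoment₂ (RkSand a (Vroad a r S) (Wroad a r S₂) u (Lc ^ k) μ ν)) ∧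
      (∀ (u : Unit ⊕ (Bool × Bool)) (k : ℕ), 1 ≤ k →
        |B12Beta.secondMoment (RkSand a (Vroad a r S) (Wroad a r S₂) u (Lc ^ k)) μ ν - (fun (_ : Unit ⊕ (Bool × Bool)) (_ : ℕ) => (0 : ℝ)) u (Lc ^ k)|
          ≤ CUsand kG K c σV (4 * ((MG163 4 * periodConst (kappa163 4) 3) * (1 + 8 * (1 + Real.exp (kappa163 4 / 4))) * Real.exp (kappa163 4 / 4))
              * (1 + 16 / (kappa163 4 / 4)) ^ 4 * (uS + mT))
            (min (kappa163 4 / 4 / 8) (min (δ₀ / 2) κc))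
            (16 * ((MG163 4 * periodConst (kappa163 4) 3) * (1 + 8 * (1 + Real.exp (kappa163 4 / 4))) * Real.exp (kappa163 4 / 4)) ^ 2
              * (1 + 16 / (kappa163 4 / 4)) ^ 4 * (1 + 4 / δ₀) ^ 4 * uT + mC true true) u) := by
  obtain ⟨hVs, hVm⟩ := jet_letters_pow (Lc := Lc) hL hr hS hCs hδS hσV.le hσVκ hσVS huS hTs hTm
  obtain ⟨hWs, hWm⟩ := table_letters_pow (Lc := Lc) (μ := μ) (ν := ν) hL hr hS₂ hCk hδ₂ hδ₀ hδ₀₂ huT hCs' hCm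
  have key := exists_END_rows_RkSand_pow (Lc := Lc) (𝒱 := Vroad a r S) (𝒲 := Wroad a r S₂) (μ := μ) (ν := ν) ha h12 h126 hσV
    (fun k hk ρ y => hVs k hk ρ y true true) (fun k hk ρ y => hVm k hk ρ y true true)
    (PackedRoadTableRows.road_tableRate_pos hδ₀ hκc) (fun k hk z => hWs k hk z true true) (fun k hk z => hWm k hk z true true)
  obtain ⟨kG, K, c, hc, hkG, hK, h1, h2, -⟩ := key
  exact ⟨kG, K, c, hc, hkG, hK, h1, h2⟩

end Rows

end Summit.QuantumFields.BalabanUV.Beta.D1BFx.PackedRoadRowsPow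

end
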